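import Literature.NumberTheory.EllipticCurves.IwasawaOrderKernelRankProofs
import Mathlib.LinearAlgebra.Dimension.Localization
import Mathlib.LinearAlgebra.Dimension.Torsion.Finite
import HarnessLib

/-!
# `ℤ_p`-finiteness and `ℤ_p`-rank bookkeeping for `Λ = ℤ_p⟦T⟧`-modules (preliminaries of the rank formula
# `rank_{ℤ_p}(X/fX) − rank_{ℤ_p}(X[f]) = deg f · rank_Λ X`; crux ♭T≤ stmt-BirchSwinnertonDyer-23042
# `DefectTransportModThreePT`, line `sigmacongruence`, brick (A1b) of the growth road to stub TS1′ `stub_twinStrictSurj`)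

Route `UniversalToricDescent`, lead prover `bsd-wall-utd-p1` g16. THEOREMS ONLY (no definition, no named fact,
no `sorry`); `--supports stmt-BirchSwinnertonDyer-23042`. BSD is not proved by any of this.

* `moduleFinite_int_of_smul_eq_zero` (whence `moduleFinite_int_quotient_smul_top`, `moduleFinite_int_torsionBy`) —
  a finitely generated `Λ`-module killed by a distinguished polynomial `f` is finitely generated over `ℤ_p` (it is a
  finitely generated `Λ/(f)`-module and `Λ/(f) ≅ ℤ_p^{deg f}`, tree `finite_quotient_pow`);
* `rank_int_lt_aleph0_of_isTorsion` — `rank_{ℤ_p} X < ℵ₀` for `X` finitely generated `Λ`-torsion (`ℚ_p ⊗ X` is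
  finite-dimensional, tree `IwasawaAlgebra.finite_baseChange_of_isTorsion`; `rank_{ℚ_p}(ℚ_p ⊗ X) = rank_{ℤ_p} X`);
* `finrank_quotient_smul_top_eq_finrank_torsionBy` — `rank_{ℤ_p}(N/gN) = rank_{ℤ_p}(N[g])` for `N` of finite
  `ℤ_p`-rank (rank–nullity for multiplication by `g`: the Herbrand-quotient identity);
* `finrank_alternatingSum_six_eq_zero` — ranks alternate to `0` along a six-term exact sequence of finitely
  generated modules over a domain (restated from `Literature.Algebra.Module.RankModPrimeElement`, private there);
* `isScalarTower_compHom` — the restricted `ℤ_p`-structure `Module.compHom` along `ℤ_p → Λ` is compatible.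

References: [Washington1997] §13.2 (Lemma 13.7, Prop. 13.8, Thm. 13.12); [NeukirchSchmidtWingberg2008] Ch. V §3.
-/

-- the Theorems namespace of this sub repeats the summit name by design (D-0017 nested layout)
set_option linter.dupNamespace false

noncomputable section

namespace Summit.BirchSwinnertonDyer.BirchSwinnertonDyer.Theorems.UniversalToricDescentTorsionFreeByCount

open Submodule Function Polynomial Literature.NumberTheory.EllipticCurves
open scoped TensorProduct Cardinal

universe u

variable (p : ℕ) [hp : Fact p.Prime]

/-! ## §1. Finite generation over `ℤ_p` of `Λ`-modules killed by a distinguished polynomial -/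

/-- **A finitely generated `Λ`-module killed by a distinguished polynomial `f` is finitely generated over `ℤ_p`**:
it is a finitely generated module over `Λ/(f)`, which is free of finite rank over `ℤ_p` (Weierstrass division,
tree `IwasawaAlgebra.finite_quotient_pow`). [cite: Washington1997, §13.2 (Prop. 13.8)] -/
theorem moduleFinite_int_of_smul_eq_zero {f : ℤ_[p][X]}
    (hf : f.IsDistinguishedAt (IsLocalRing.maximalIdeal ℤ_[p])) (N : Type u) [AddCommGroup N]
    [Module (IwasawaAlgebra p) N] [Module ℤ_[p] N] [IsScalarTower ℤ_[p] (IwasawaAlgebra p) N]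
    [Module.Finite (IwasawaAlgebra p) N] (hN : ∀ x : N, (f : IwasawaAlgebra p) • x = 0) :
    Module.Finite ℤ_[p] N := by
  have hT : Module.IsTorsionBySet (IwasawaAlgebra p) N (Ideal.span {(f : IwasawaAlgebra p)}) :=
    (Module.isTorsionBySet_span_singleton_iff _).mpr fun x => hN x
  letI := hT.module
  haveI := hT.isScalarTower (S := IwasawaAlgebra p)
  haveI := hT.isScalarTower (S := ℤ_[p])
  haveI : Module.Finite (IwasawaAlgebra p ⧸ Ideal.span {(f : IwasawaAlgebra p)}) N :=
    Module.Finite.of_restrictScalars_finite (IwasawaAlgebra p) _ _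
  haveI : Module.Finite ℤ_[p] (IwasawaAlgebra p ⧸ Ideal.span {(f : IwasawaAlgebra p)}) := by
    have h := finite_quotient_pow p hf 1
    rwa [pow_one] at h
  exact Module.Finite.trans (IwasawaAlgebra p ⧸ Ideal.span {(f : IwasawaAlgebra p)}) N

/-- `X/fX` is finitely generated over `ℤ_p` (`X` finitely generated over `Λ`, `f` distinguished).
[cite: Washington1997, §13.2 (Prop. 13.8)] -/
theorem moduleFinite_int_quotient_smul_top {f : ℤ_[p][X]}
    (hf : f.IsDistinguishedAt (IsLocalRing.maximalIdeal ℤ_[p])) (N : Type u) [AddCommGroup N]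
    [Module (IwasawaAlgebra p) N] [Module ℤ_[p] N] [IsScalarTower ℤ_[p] (IwasawaAlgebra p) N]
    [Module.Finite (IwasawaAlgebra p) N] :
    Module.Finite ℤ_[p] (N ⧸ (Ideal.span {(f : IwasawaAlgebra p)} • ⊤ :
      Submodule (IwasawaAlgebra p) N)) := by
  refine moduleFinite_int_of_smul_eq_zero p hf _ fun x => ?_
  obtain ⟨x, rfl⟩ := Submodule.mkQ_surjective _ x
  rw [Submodule.mkQ_apply, ← Submodule.Quotient.mk_smul, Submodule.Quotient.mk_eq_zero]
  exact Submodule.smul_mem_smul (Ideal.mem_span_singleton_self _) Submodule.mem_top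

/-- `X[f]` is finitely generated over `ℤ_p` (`X` finitely generated over `Λ`, `f` distinguished).
[cite: Washington1997, §13.2 (Prop. 13.8)] -/
theorem moduleFinite_int_torsionBy {f : ℤ_[p][X]}
    (hf : f.IsDistinguishedAt (IsLocalRing.maximalIdeal ℤ_[p])) (N : Type u) [AddCommGroup N]
    [Module (IwasawaAlgebra p) N] [Module ℤ_[p] N] [IsScalarTower ℤ_[p] (IwasawaAlgebra p) N]
    [Module.Finite (IwasawaAlgebra p) N] :
    Module.Finite ℤ_[p] (torsionBy (IwasawaAlgebra p) N (f : IwasawaAlgebra p)) := by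
  haveI : IsNoetherian (IwasawaAlgebra p) N := isNoetherian_of_isNoetherianRing_of_finite _ _
  haveI : Module.Finite (IwasawaAlgebra p) (torsionBy (IwasawaAlgebra p) N (f : IwasawaAlgebra p)) :=
    Module.Finite.of_injective (Submodule.subtype _) Subtype.val_injective
  refine moduleFinite_int_of_smul_eq_zero p hf _ fun x => ?_
  exact Subtype.ext ((mem_torsionBy_iff _ (x : N)).mp x.2)

/-! ## §2. `ℤ_p`-ranks -/

/-- **`rank_{ℤ_p} X < ℵ₀` for a finitely generated torsion `Λ`-module** (`ℚ_p ⊗ X` is finite-dimensional, tree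
`IwasawaAlgebra.finite_baseChange_of_isTorsion`, and `rank_{ℚ_p}(ℚ_p ⊗ X) = rank_{ℤ_p} X`).
[cite: Washington1997, §13.2 (Thm. 13.12, definition of λ)] -/
theorem rank_int_lt_aleph0_of_isTorsion (N : Type u) [AddCommGroup N] [Module (IwasawaAlgebra p) N]
    [Module ℤ_[p] N] [IsScalarTower ℤ_[p] (IwasawaAlgebra p) N] [Module.Finite (IwasawaAlgebra p) N]
    (hN : Module.IsTorsion (IwasawaAlgebra p) N) : Module.rank ℤ_[p] N < ℵ₀ := by
  haveI := IwasawaAlgebra.finite_baseChange_of_isTorsion p hN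
  rw [← (TensorProduct.isBaseChange (R := ℤ_[p]) (M := N) (S := ℚ_[p])).rank_eq]
  exact Module.rank_lt_aleph0 ℚ_[p] _

/-- Rank–nullity for an endomorphism of a module of finite rank over a domain: if `rank M < ℵ₀` then
`rank (M ⧸ im φ) = rank (ker φ)`. [folklore] -/
theorem finrank_quotient_range_eq_finrank_ker {R : Type*} [CommRing R] [IsDomain R] {M : Type u}
    [AddCommGroup M] [Module R M] (hM : Module.rank R M < ℵ₀) (φ : M →ₗ[R] M) :
    Module.finrank R (M ⧸ LinearMap.range φ) = Module.finrank R (LinearMap.ker φ) := by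
  have h1 := LinearMap.rank_range_add_rank_ker φ
  have h2 := Submodule.rank_quotient_add_rank (LinearMap.range φ)
  have hr : Module.rank R (LinearMap.range φ) < ℵ₀ :=
    lt_of_le_of_lt (by rw [← h1]; exact le_self_add) hM
  have hk : Module.rank R (LinearMap.ker φ) < ℵ₀ :=
    lt_of_le_of_lt (by rw [← h1]; exact le_add_self) hM
  have hq : Module.rank R (M ⧸ LinearMap.range φ) < ℵ₀ :=
    lt_of_le_of_lt (by rw [← h2]; exact le_self_add) hM
  have e1 := congrArg Cardinal.toNat h1
  have e2 := congrArg Cardinal.toNat h2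
  rw [Cardinal.toNat_add hr hk] at e1
  rw [Cardinal.toNat_add hq hr] at e2
  unfold Module.finrank
  omega

/-- **`rank_{ℤ_p}(N/gN) = rank_{ℤ_p}(N[g])` for a `Λ`-module `N` of finite `ℤ_p`-rank and any `g ∈ Λ`**
(rank–nullity for multiplication by `g`; the Herbrand-quotient identity for torsion Iwasawa modules).
[cite: Washington1997, §13.2] [cite: NeukirchSchmidtWingberg2008, Ch. V §3] -/
theorem finrank_quotient_smul_top_eq_finrank_torsionBy (N : Type u) [AddCommGroup N]
    [Module (IwasawaAlgebra p) N] [Module ℤ_[p] N] [IsScalarTower ℤ_[p] (IwasawaAlgebra p) N]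
    (hN : Module.rank ℤ_[p] N < ℵ₀) (g : IwasawaAlgebra p) :
    Module.finrank ℤ_[p] (N ⧸ (Ideal.span {g} • ⊤ : Submodule (IwasawaAlgebra p) N)) =
      Module.finrank ℤ_[p] (torsionBy (IwasawaAlgebra p) N g) := by
  let φ : N →ₗ[ℤ_[p]] N := (LinearMap.lsmul (IwasawaAlgebra p) N g).restrictScalars ℤ_[p]
  have hφ : ∀ x, φ x = g • x := fun x => rfl
  have hker : ∀ x, x ∈ LinearMap.ker φ ↔ x ∈ torsionBy (IwasawaAlgebra p) N g := fun x => by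
    rw [LinearMap.mem_ker, hφ, mem_torsionBy_iff]
  have hrange : LinearMap.range φ =
      (Ideal.span {g} • ⊤ : Submodule (IwasawaAlgebra p) N).restrictScalars ℤ_[p] := by
    ext x
    rw [Submodule.restrictScalars_mem, Submodule.ideal_span_singleton_smul,
      Submodule.mem_smul_pointwise_iff_exists, LinearMap.mem_range]
    constructor
    · rintro ⟨y, rfl⟩; exact ⟨y, Submodule.mem_top, hφ y⟩
    · rintro ⟨y, -, rfl⟩; exact ⟨y, hφ y⟩
  have h := finrank_quotient_range_eq_finrank_ker hN φ
  let e₁ : LinearMap.ker φ ≃ₗ[ℤ_[p]] torsionBy (IwasawaAlgebra p) N g :=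
    { toFun := fun x => ⟨x, (hker x).mp x.2⟩
      invFun := fun x => ⟨x, (hker x).mpr x.2⟩
      map_add' := fun _ _ => rfl
      map_smul' := fun _ _ => rfl
      left_inv := fun _ => rfl
      right_inv := fun _ => rfl }
  let e₂ : (N ⧸ LinearMap.range φ) ≃ₗ[ℤ_[p]]
      (N ⧸ (Ideal.span {g} • ⊤ : Submodule (IwasawaAlgebra p) N)) :=
    (Submodule.quotEquivOfEq _ _ hrange).trans (Submodule.Quotient.restrictScalarsEquiv ℤ_[p] _)
  rw [← e₁.finrank_eq, ← e₂.finrank_eq, h]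

/-- Rank–nullity over a domain, `finrank` form, for a linear map out of a finitely generated module. [folklore] -/
theorem finrank_eq_finrank_ker_add_finrank_range {A : Type*} [CommRing A] [IsDomain A] {M N : Type u}
    [AddCommGroup M] [Module A M] [AddCommGroup N] [Module A N] [Module.Finite A M] (φ : M →ₗ[A] N) :
    Module.finrank A M = Module.finrank A (LinearMap.ker φ) + Module.finrank A (LinearMap.range φ) := by
  rw [← φ.quotKerEquivRange.finrank_eq, add_comm, Submodule.finrank_quotient_add_finrank]

/-- **The alternating sum of ranks along a six-term exact sequence of finitely generated modules over a domain
vanishes** (the bookkeeping of `Literature.Algebra.Module.RankModPrimeElement`, restated because it is private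
there). [folklore] -/
theorem finrank_alternatingSum_six_eq_zero {A : Type*} [CommRing A] [IsDomain A]
    {M₁ M₂ M₃ M₄ M₅ M₆ : Type u}
    [AddCommGroup M₁] [Module A M₁] [Module.Finite A M₁] [AddCommGroup M₂] [Module A M₂]
    [Module.Finite A M₂] [AddCommGroup M₃] [Module A M₃] [Module.Finite A M₃] [AddCommGroup M₄]
    [Module A M₄] [Module.Finite A M₄] [AddCommGroup M₅] [Module A M₅] [Module.Finite A M₅]
    [AddCommGroup M₆] [Module A M₆] [Module.Finite A M₆]
    (φ₁ : M₁ →ₗ[A] M₂) (φ₂ : M₂ →ₗ[A] M₃) (φ₃ : M₃ →ₗ[A] M₄) (φ₄ : M₄ →ₗ[A] M₅)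
    (φ₅ : M₅ →ₗ[A] M₆) (h₁ : Injective φ₁) (h₁₂ : Exact φ₁ φ₂) (h₂₃ : Exact φ₂ φ₃)
    (h₃₄ : Exact φ₃ φ₄) (h₄₅ : Exact φ₄ φ₅) (h₅ : Surjective φ₅) :
    (Module.finrank A M₁ : ℤ) - Module.finrank A M₂ + Module.finrank A M₃ - Module.finrank A M₄ +
      Module.finrank A M₅ - Module.finrank A M₆ = 0 := by
  have e₁ := finrank_eq_finrank_ker_add_finrank_range φ₁
  have e₂ := finrank_eq_finrank_ker_add_finrank_range φ₂
  have e₃ := finrank_eq_finrank_ker_add_finrank_range φ₃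
  have e₄ := finrank_eq_finrank_ker_add_finrank_range φ₄
  have e₅ := finrank_eq_finrank_ker_add_finrank_range φ₅
  have k₁ : Module.finrank A (LinearMap.ker φ₁) = 0 := by
    rw [LinearMap.ker_eq_bot.mpr h₁, finrank_bot]
  have k₂ : Module.finrank A (LinearMap.ker φ₂) = Module.finrank A (LinearMap.range φ₁) := by
    rw [LinearMap.exact_iff.mp h₁₂]
  have k₃ : Module.finrank A (LinearMap.ker φ₃) = Module.finrank A (LinearMap.range φ₂) := by
    rw [LinearMap.exact_iff.mp h₂₃]
  have k₄ : Module.finrank A (LinearMap.ker φ₄) = Module.finrank A (LinearMap.range φ₃) := by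
    rw [LinearMap.exact_iff.mp h₃₄]
  have k₅ : Module.finrank A (LinearMap.ker φ₅) = Module.finrank A (LinearMap.range φ₄) := by
    rw [LinearMap.exact_iff.mp h₄₅]
  have r₅ : Module.finrank A (LinearMap.range φ₅) = Module.finrank A M₆ := by
    rw [LinearMap.range_eq_top.mpr h₅, finrank_top]
  omega

/-- The `ℤ_p`-structure restricted along `ℤ_p → Λ` is compatible (`IsScalarTower`). [folklore] -/
theorem isScalarTower_compHom (N : Type u) [AddCommGroup N] [Module (IwasawaAlgebra p) N] :
    letI : Module ℤ_[p] N := Module.compHom N (algebraMap ℤ_[p] (IwasawaAlgebra p))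
    IsScalarTower ℤ_[p] (IwasawaAlgebra p) N :=
  letI : Module ℤ_[p] N := Module.compHom N (algebraMap ℤ_[p] (IwasawaAlgebra p))
  IsScalarTower.of_algebraMap_smul fun _ _ => rfl

end Summit.BirchSwinnertonDyer.BirchSwinnertonDyer.Theorems.UniversalToricDescentTorsionFreeByCount

end
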